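import Mathlib
import Summits.CriticalPhenomena.PercolationContinuityZ3.Theorems.PercNearOneGluingNoHeavyLowerTailOrientedAntipodalHallAcyclic
import Summits.CriticalPhenomena.PercolationContinuityZ3.Theorems.PercNearOneGluingNoHeavyLowerTailThreeFamilyOrderedMiddle
import Summits.CriticalPhenomena.PercolationContinuityZ3.Theorems.PercNearOneGluingNoHeavyLowerTailOrientedAntipodalHallTransitive

/-!
# Label calculus for partial one-sided enlargements; two B-orthogonal ranked Marica–Schönheim families

Helper file for crux `stmt-CriticalPhenomena-4575` (`NoHeavyLowerTail`, route `PercNearOneGluingNoHeavy`),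
new-inequality factory seat `prim-ineq-gen-3` (gen 13).  Everything here is PROVED.

Setting of `…OrientedAntipodalHall`: `f : Finset α → Lab k` monotone, ground set `S`, a family `D` of antipodal
bads.  For a set `R` of petals the PARTIAL ONE-SIDED ENLARGEMENT of the co-goods above `D` is
`G_R = {F ⊆ S : f F = B, f (S \ F) ∈ {A} ∪ C_R, F ⊆ S \ X for some X ∈ D}` (down-closed).  This file proves the
LABEL CALCULUS in `G_R` — when a difference `U \ U'` or a meet `U ∩ U'` of two sets with known set-label `f U`
and complement-label `f (S \ U)` is certified to lie in `G_R`, when a meet is nonempty, when two sets cannot be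
nested (`sdiff_mem_enlarged`, `inter_mem_enlarged`, `inter_nonempty_of_labels`, `not_subset_of_labels`) — and
the abstract count for TWO B-orthogonal ranked Marica–Schönheim families
(`ThreeFamilyRank.card_add_card_le_of_rank`).  They are assembled into the uniform two-group certificate theorem
in `…OrientedAntipodalHallTwoGroupCertificate`.  (prim-ineq-gen-3 gen 13, 2026-08-21; memo FINDINGS-gen13.md in
`run/shared/lean/prim/prim-ineq-gen-3/`.)
-/

namespace Summit.CriticalPhenomena.PercolationContinuityZ3.Theorems

namespace ThreeFamilyRank

open Finset Module
open scoped FinsetFamily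

variable {α : Type*} [DecidableEq α]

/-- A ranked Marica–Schönheim family spans a space of dimension equal to its size. -/
theorem finrank_V_of_rank (G : Finset (Finset α)) (hG : ∀ E ∈ G, ∀ F, F ⊆ E → F ∈ G)
    (P : Finset (Finset α)) (ρ : Finset α → ℕ)
    (hdiff : ∀ X ∈ P, ∀ X' ∈ P, ρ X ≤ ρ X' → X \ X' ∈ G)
    (hnc : ∀ X ∈ P, ∀ X' ∈ P, ρ X < ρ X' → ¬ X ⊆ X') :
    finrank ℚ (V G P) = #P := by
  rw [V, finrank_span_eq_card (linearIndependent_chi_of_rank G hG P ρ hdiff hnc)]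
  simp

/-- **Two B-orthogonal ranked Marica–Schönheim families.**  If `P` and `Q` are ranked Marica–Schönheim families of
`ℚ^G` (`G` down-closed) and every cross meet `X ∩ Y` lies in `G` and is nonempty, then `#P + #Q ≤ #G`. -/
theorem card_add_card_le_of_rank (G : Finset (Finset α)) (hG : ∀ E ∈ G, ∀ F, F ⊆ E → F ∈ G)
    (P Q : Finset (Finset α)) (ρ σ : Finset α → ℕ)
    (hPd : ∀ X ∈ P, ∀ X' ∈ P, ρ X ≤ ρ X' → X \ X' ∈ G) (hPn : ∀ X ∈ P, ∀ X' ∈ P, ρ X < ρ X' → ¬ X ⊆ X')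
    (hQd : ∀ Y ∈ Q, ∀ Y' ∈ Q, σ Y ≤ σ Y' → Y \ Y' ∈ G) (hQn : ∀ Y ∈ Q, ∀ Y' ∈ Q, σ Y < σ Y' → ¬ Y ⊆ Y')
    (hPQ : ∀ X ∈ P, ∀ Y ∈ Q, X ∩ Y ∈ G ∧ (X ∩ Y).Nonempty) :
    #P + #Q ≤ #G := by
  have hP := finrank_V_of_rank G hG P ρ hPd hPn
  have hQ := finrank_V_of_rank G hG Q σ hQd hQn
  have hE : finrank ℚ (V G (∅ : Finset (Finset α))) = #(∅ : Finset (Finset α)) :=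
    finrank_V G hG ∅ (by simp)
  have h := card_add_card_add_card_le_of_finrank G hG P Q ∅ hP hQ hE hPQ (by simp) (by simp)
  have hbot : V G (∅ : Finset (Finset α)) = ⊥ := by
    apply Submodule.finrank_eq_zero.mp
    rw [hE]; simp
  rw [hbot, inf_bot_eq, finrank_bot] at h
  simpa using h

end ThreeFamilyRank

namespace OrientedAntipodalHall

open Finset Module AntipodalStrongHarris AntipodalStrongHarris.Lab ThreeFamilyRank
open scoped FinsetFamily

variable {α : Type*} [DecidableEq α] {k : ℕ}

/-- A label above a petal is that petal or `A`. -/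
theorem eq_or_eq_top_of_petal_le {i : Fin k} {c : Lab k} (h : petal i ≤ c) : c = petal i ∨ c = top := by
  rw [le_def] at h
  rcases h with h | h | h
  · exact absurd h (by simp)
  · exact Or.inr h
  · exact Or.inl h.symm

section Calculus

variable (S : Finset α) {f : Finset α → Lab k} (D : Finset (Finset α)) (R : Finset (Fin k))

/-- **Label calculus, differences.**  In the partial one-sided enlargement `G_R`, the difference `U \ U'` is certified
when the set-label of `U` is `B` or a petal different from the complement-label of `U'`, and the complement-label
of `U` lies in `R` or differs from the (petal) set-label of `U'`. -/
theorem sdiff_mem_enlarged (hf : ∀ ⦃X Y : Finset α⦄, X ⊆ Y → f X ≤ f Y) (G : Finset (Finset α))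
    (hG : G = {F ∈ S.powerset | f F = bot ∧ (f (S \ F) = top ∨ ∃ r ∈ R, f (S \ F) = petal r) ∧
      ∃ X ∈ D, F ⊆ S \ X})
    {U U' : Finset α} {b b' : Fin k} (hUS : U ⊆ S) (hU'S : U' ⊆ S) (hUb : f (S \ U) = petal b)
    (hU'b : f (S \ U') = petal b') (hmiss : ∃ X ∈ D, U ⊆ S \ X)
    (h1 : f U = bot ∨ ∃ a, f U = petal a ∧ a ≠ b') (h2 : b ∈ R ∨ ∃ a', f U' = petal a' ∧ b ≠ a') :
    U \ U' ∈ G := by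
  obtain ⟨X, hX, hUX⟩ := hmiss
  rw [hG, mem_filter, mem_powerset]
  refine ⟨sdiff_subset.trans hUS, ?_, ?_, X, hX, sdiff_subset.trans hUX⟩
  · rcases h1 with hbot | ⟨a, ha, hab⟩
    · exact eq_bot_of_le_bot (hbot ▸ hf (sdiff_subset : U \ U' ⊆ U))
    · refine eq_bot_of_le_petal hab (ha ▸ hf (sdiff_subset : U \ U' ⊆ U)) (hU'b ▸ hf ?_)
      intro x hx
      rw [mem_sdiff] at hx ⊢
      exact ⟨hUS hx.1, hx.2⟩
  · have hge : petal b ≤ f (S \ (U \ U')) := hUb ▸ hf (sdiff_subset_sdiff le_rfl sdiff_subset)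
    rcases h2 with hbR | ⟨a', ha', hba⟩
    · rcases eq_or_eq_top_of_petal_le hge with h | h
      · exact Or.inr ⟨b, hbR, h⟩
      · exact Or.inl h
    · refine Or.inl (eq_top_of_petal_le hba hge (ha' ▸ hf ?_))
      intro x hx
      rw [mem_sdiff]
      refine ⟨hU'S hx, fun h => (mem_sdiff.mp h).2 hx⟩

/-- **Label calculus, meets.**  In `G_R` the meet `U ∩ U'` is certified when one set-label is `B` or the two
set-labels are different petals, and the complement-labels differ or lie in `R`. -/
theorem inter_mem_enlarged (hf : ∀ ⦃X Y : Finset α⦄, X ⊆ Y → f X ≤ f Y) (G : Finset (Finset α))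
    (hG : G = {F ∈ S.powerset | f F = bot ∧ (f (S \ F) = top ∨ ∃ r ∈ R, f (S \ F) = petal r) ∧
      ∃ X ∈ D, F ⊆ S \ X})
    {U U' : Finset α} {b b' : Fin k} (hUS : U ⊆ S) (hUb : f (S \ U) = petal b)
    (hU'b : f (S \ U') = petal b') (hmiss : ∃ X ∈ D, U ⊆ S \ X)
    (h1 : f U = bot ∨ f U' = bot ∨ ∃ a a', f U = petal a ∧ f U' = petal a' ∧ a ≠ a')
    (h2 : b ≠ b' ∨ b ∈ R) : U ∩ U' ∈ G := by
  obtain ⟨X, hX, hUX⟩ := hmiss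
  rw [hG, mem_filter, mem_powerset]
  refine ⟨inter_subset_left.trans hUS, ?_, ?_, X, hX, inter_subset_left.trans hUX⟩
  · rcases h1 with hbot | hbot | ⟨a, a', ha, ha', haa⟩
    · exact eq_bot_of_le_bot (hbot ▸ hf (inter_subset_left : U ∩ U' ⊆ U))
    · exact eq_bot_of_le_bot (hbot ▸ hf (inter_subset_right : U ∩ U' ⊆ U'))
    · exact eq_bot_of_le_petal haa (ha ▸ hf inter_subset_left) (ha' ▸ hf inter_subset_right)
  · have hge : petal b ≤ f (S \ (U ∩ U')) := hUb ▸ hf (sdiff_subset_sdiff le_rfl inter_subset_left)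
    have hge' : petal b' ≤ f (S \ (U ∩ U')) := hU'b ▸ hf (sdiff_subset_sdiff le_rfl inter_subset_right)
    rcases h2 with hbb | hbR
    · exact Or.inl (eq_top_of_petal_le hbb hge hge')
    · rcases eq_or_eq_top_of_petal_le hge with h | h
      · exact Or.inr ⟨b, hbR, h⟩
      · exact Or.inl h

omit [DecidableEq α] in
/-- **Label calculus, nonempty meets.**  If the set-label of `U` is a petal different from the complement-label of
`U'` (and `U ⊆ S`), then `U ∩ U' ≠ ∅`. -/
theorem inter_nonempty_of_labels [DecidableEq α] (hf : ∀ ⦃X Y : Finset α⦄, X ⊆ Y → f X ≤ f Y)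
    {U U' : Finset α} {a b' : Fin k} (hUS : U ⊆ S) (hUa : f U = petal a) (hU'b : f (S \ U') = petal b')
    (hab : a ≠ b') : (U ∩ U').Nonempty := by
  rw [Finset.nonempty_iff_ne_empty]
  intro h
  have hsub : U ⊆ S \ U' := by
    intro x hx
    rw [mem_sdiff]
    refine ⟨hUS hx, fun hx' => ?_⟩
    have : x ∈ U ∩ U' := mem_inter.mpr ⟨hx, hx'⟩
    rw [h] at this
    exact absurd this (by simp)
  have hle := hf hsub
  rw [hUa, hU'b, petal_le_petal_iff] at hle
  exact hab hle

omit [DecidableEq α] in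
/-- **Label calculus, non-containment.**  Sets with different complement-labels are not nested; a set with a petal
set-label is not inside a set with set-label `B` or with a different petal set-label. -/
theorem not_subset_of_labels [DecidableEq α] (hf : ∀ ⦃X Y : Finset α⦄, X ⊆ Y → f X ≤ f Y) {U U' : Finset α}
    (h : (∃ b b', f (S \ U) = petal b ∧ f (S \ U') = petal b' ∧ b ≠ b') ∨
      (∃ a, f U = petal a ∧ f U' = bot) ∨ (∃ a a', f U = petal a ∧ f U' = petal a' ∧ a ≠ a')) :
    ¬ U ⊆ U' := by
  intro hsub
  rcases h with ⟨b, b', hb, hb', hbb⟩ | ⟨a, ha, hbot⟩ | ⟨a, a', ha, ha', haa⟩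
  · have hle := hf (sdiff_subset_sdiff (le_refl S) hsub)
    rw [hb, hb', petal_le_petal_iff] at hle
    exact hbb hle.symm
  · have hle := hf hsub
    rw [ha, hbot, le_def] at hle
    rcases hle with h | h | h <;> simp at h
  · have hle := hf hsub
    rw [ha, ha', petal_le_petal_iff] at hle
    exact haa hle

end Calculus

end OrientedAntipodalHall

end Summit.CriticalPhenomena.PercolationContinuityZ3.Theorems
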